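import Summits.ABC.IUTFork.Repair.RHHeightScaling
import Summits.ABC.IUTFork.Repair.RHHeightScalingBarrier
import HarnessLib

/-!
# R-H ROUND 3, AXIS D2 — JUNCTION of the two typers' files: abc-iut-rh2-T-1's vocabulary / DOOR side (`RHHeightScaling`: `ExponentAtMost`,
# `NegExponent`, `Door`, `PriceBounded`) and abc-iut-rh2-w-2's BARRIER side (`RHHeightScalingBarrier`: `PowerBoundFrom`, `ClosedBy`,
# `NeverClosedFrom`, `Barrier`, `barrierScale`) — ONE admissibility table gives BOTH «no door» AND «no closing from an explicit height on»
# (PROOF-ONLY, 0 definitions)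

abc-iut cell, rung LADDER-ABC:A2.RESCUE.H, round-3 AXIS D2 (21-frontier 2026-08-27T11:38:40Z; D-0130; KEYs D2-TYPE-BARRIER / D2-TYPE-DOOR; desk
`plan/rescue/R-H/ROUND3/AXIS-CD-DESK.md` §D2 «typer rh2-T-1 fixes the Lean vocabulary, coordinate names with rh2-w-2»). Seat abc-iut-rh2-w-2.
WHAT IS PROVED (namespace `Summit.ABC.IUTFork.Repair.RH.HeightScalingBarrier`, all [folklore] real analysis):
* §1 `exponentAtMost_iff_powerBoundFrom` — T-1's `ExponentAtMost f α C` IS `PowerBoundFrom f α C 1` (`Iff.rfl`); `neverClosedFrom_of_exponentAtMost`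
  (fraction profiles with `ExponentAtMost (g i) (α i) (C i)`, `α i ≤ a < 0` ⇒ the masses `g_i(s)·(M₁ s)` never close `M₁ s − tol` from
  `barrierScale M₁ tol 1 (a+1) (Σ max(C_i·M₁, 0))` on).
* §2 **`not_door_and_barrier_of_table`** — if an admissibility table `Φ` admits, for the classes in `X`, only profiles with exponents `≤ a < 0`
  (non-negative constants), then (i) `¬ Door Φ X` (T-1's `not_door_of_forall_negExponent`) AND (ii) every finite family of admitted objects never closes
  the requirement from some explicit dilation on (this seat's `barrier_holds` mechanism): the BARRIER/DOOR dichotomy decided on the barrier side for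
  such tables, in one statement.
* §3 **`not_closedBy_of_priceBounded`** — T-1's `PriceBounded M₁` profiles (certificate `≤ P̄` height-free over the total `s·M₁`: the conductor-type
  classes of record at conjugate fibres, T-1 §2/§3) never close `M₁ s − tol` at any `s ≥ 1` with `s > (Σ P̄_i + tol)/M₁` — the SHARP threshold of
  `not_closedBy_of_heightFree`, next to T-1's `not_door_of_priceBounded`.
HONEST FRAMING: elementary real analysis joining two typed vocabularies; nothing here asserts that abc is proved or refuted, or that [IUTchIII] Cor. 3.12 /
[IUTchIV] Thm. 1.10 holds or fails at any datum, or takes a side on any author; doors / barriers are claim-tagged hypothesis shapes about OUR typed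
object classes; typed ≠ proved for the class laws plugged in.
-/

noncomputable section

open Finset

namespace Summit.ABC.IUTFork.Repair.RH.HeightScalingBarrier

open Summit.ABC.IUTFork.Repair.RH.HeightScaling

variable {k : ℕ}

/-! ## §1. The two vocabularies agree -/

/-- abc-iut-rh2-T-1's `ExponentAtMost f α C` is this seat's `PowerBoundFrom f α C 1` (onset `1`), definitionally. [folklore] -/
theorem exponentAtMost_iff_powerBoundFrom (f : ℝ → ℝ) (α C : ℝ) :
    ExponentAtMost f α C ↔ PowerBoundFrom f α C 1 :=
  Iff.rfl

/-- **Fraction profiles with negative exponents never close the requirement, explicit threshold** (T-1's hypotheses by name): if the recovered-FRACTION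
profiles `g_i` (fractions of the total `M(s) = M₁·s`) satisfy `ExponentAtMost (g i) (α i) (C i)` with `α i ≤ a < 0`, the masses `g_i(s)·(M₁·s)` do not
close `M₁·s − tol` at any `s ≥ barrierScale M₁ tol 1 (a+1) (Σ_i max(C_i·M₁, 0))`. [folklore] -/
theorem neverClosedFrom_of_exponentAtMost {g : Fin k → ℝ → ℝ} {α C : Fin k → ℝ} {a M₁ tol : ℝ}
    (hM : 0 < M₁) (ha : a < 0) (hα : ∀ i, α i ≤ a) (hg : ∀ i, ExponentAtMost (g i) (α i) (C i)) :
    NeverClosedFrom (fun i s => g i s * (M₁ * s)) M₁ tol (barrierScale M₁ tol 1 (a + 1) (posConstSum fun i => C i * M₁)) :=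
  neverClosedFrom_of_fractionExponents_lt_zero hM ha hα hg

/-! ## §2. One table, both verdicts: no door and no closing -/

/-- **BARRIER AND NO DOOR FROM ONE ADMISSIBILITY TABLE.** Suppose that for every class `κ ∈ X` every admitted recovered-fraction profile `g ∈ Φ κ`
has `ExponentAtMost g α C` for some `α ≤ a` (one `a < 0` for the whole table) and `C ≥ 0`. Then (i) NO combination of classes in `X` is a door
(abc-iut-rh2-T-1 `not_door_of_forall_negExponent`), and (ii) for every slope `M₁ > 0`, tolerance `tol` and every finite family `g : Fin k → _` of admitted
profiles of classes in `X` there is an (explicit, `barrierScale`) dilation `s₀` from which on the masses `g_i(s)·(M₁·s)` NEVER close `M₁·s − tol`.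
[folklore] -/
theorem not_door_and_barrier_of_table {Φ : ObjectClass → Set (ℝ → ℝ)} {X : Set ObjectClass} {a : ℝ} (ha : a < 0)
    (hΦ : ∀ κ ∈ X, ∀ g ∈ Φ κ, ∃ α C : ℝ, α ≤ a ∧ 0 ≤ C ∧ ExponentAtMost g α C) :
    ¬ Door Φ X ∧
      ∀ (M₁ tol : ℝ), 0 < M₁ → ∀ (k : ℕ) (g : Fin k → ℝ → ℝ), (∀ i, ∃ κ ∈ X, g i ∈ Φ κ) →
        ∃ s₀ : ℝ, NeverClosedFrom (fun i s => g i s * (M₁ * s)) M₁ tol s₀ := by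
  refine ⟨not_door_of_forall_negExponent fun κ hκ g hg => ?_, fun M₁ tol hM k g hg => ?_⟩
  · obtain ⟨α, C, hαa, hC, hexp⟩ := hΦ κ hκ g hg
    exact ⟨α, C, lt_of_le_of_lt hαa ha, hC, hexp⟩
  · have hex : ∀ i, ∃ αC : ℝ × ℝ, αC.1 ≤ a ∧ 0 ≤ αC.2 ∧ ExponentAtMost (g i) αC.1 αC.2 := fun i => by
      obtain ⟨κ, hκ, hgi⟩ := hg i
      obtain ⟨α, C, hαa, hC, hexp⟩ := hΦ κ hκ (g i) hgi
      exact ⟨(α, C), hαa, hC, hexp⟩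
    choose αC hαC using hex
    exact ⟨_, neverClosedFrom_of_exponentAtMost (α := fun i => (αC i).1) (C := fun i => (αC i).2) hM ha
      (fun i => (hαC i).1) fun i => (hαC i).2.2⟩

/-! ## §3. Price-bounded (conductor-type) profiles: the sharp threshold -/

/-- **PRICE-BOUNDED PROFILES NEVER CLOSE BEYOND `(Σ P̄_i + tol)/M₁`** (sharp conductor-type form): if each profile `g_i` is the recovered fraction of a
certificate `cert_i ≤ P̄_i` (height-free, `s ≥ 1`) over the total `s·M₁` — abc-iut-rh2-T-1's `PriceBounded M₁ (g i)` with its witnesses named — then the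
masses `g_i(s)·(M₁·s) = cert_i(s)` do not close `M₁·s − tol` at any `s ≥ 1` with `(Σ_i P̄_i + tol)/M₁ < s`. [folklore] -/
theorem not_closedBy_of_priceBounded {g cert : Fin k → ℝ → ℝ} {Pbar : Fin k → ℝ} {M₁ tol s : ℝ} (hM : 0 < M₁)
    (hcert : ∀ i, ∀ s' : ℝ, 1 ≤ s' → cert i s' ≤ Pbar i) (hg : ∀ i, ∀ s' : ℝ, 1 ≤ s' → g i s' = cert i s' / (s' * M₁))
    (h1 : 1 ≤ s) (hs : (∑ i, Pbar i + tol) / M₁ < s) :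
    ¬ ClosedBy (fun i s => g i s * (M₁ * s)) M₁ tol s := by
  refine not_closedBy_of_heightFree (C := Pbar) (s₁ := 1) hM (fun i s' hs' => ?_) h1 hs
  have hs0 : 0 < s' := lt_of_lt_of_le zero_lt_one hs'
  have hne : s' * M₁ ≠ 0 := mul_ne_zero hs0.ne' hM.ne'
  have : g i s' * (M₁ * s') = cert i s' := by
    rw [hg i s' hs', mul_comm M₁ s', div_mul_cancel₀ _ hne]
  rw [this]
  exact hcert i s' hs'

/-- The `PriceBounded` packaging of §3: each `PriceBounded M₁ (g i)` profile admits witnesses as above, so SOME height-free constants bar closing from an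
explicit dilation on. [folklore] -/
theorem exists_neverClosedFrom_of_priceBounded {g : Fin k → ℝ → ℝ} {M₁ : ℝ} (hM : 0 < M₁) (tol : ℝ)
    (hg : ∀ i, PriceBounded M₁ (g i)) :
    ∃ Pbar : Fin k → ℝ, NeverClosedFrom (fun i s => g i s * (M₁ * s)) M₁ tol (max 1 ((∑ i, Pbar i + tol) / M₁ + 1)) := by
  have hex : ∀ i, ∃ cP : (ℝ → ℝ) × ℝ, (∀ s : ℝ, 1 ≤ s → cP.1 s ≤ cP.2) ∧ ∀ s : ℝ, 1 ≤ s → g i s = cP.1 s / (s * M₁) := fun i => by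
    obtain ⟨cert, Pbar, hc, hf⟩ := hg i
    exact ⟨(cert, Pbar), hc, hf⟩
  choose cP hcP using hex
  refine ⟨fun i => (cP i).2, fun s hs => ?_⟩
  have h1 : 1 ≤ s := le_trans (le_max_left _ _) hs
  have h2 : (∑ i, (cP i).2 + tol) / M₁ < s := by
    have := le_trans (le_max_right _ _) hs
    linarith
  exact not_closedBy_of_priceBounded (cert := fun i => (cP i).1) hM (fun i => (hcP i).1) (fun i => (hcP i).2) h1 h2

end Summit.ABC.IUTFork.Repair.RH.HeightScalingBarrier

end
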